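import Mathlib
import Summits.Ventures.HodgeRepro2.T5RamifiedQuadraticDictionary

/-!
# The ramification index of a DVR pair is the exponent of the uniformiser relation

Tier-5 support for the (A13) step of §N5.13.2 (route/T5-route-2.md), continuing
`T5RamifiedQuadraticDictionary` (p394885).  There the hypothesis «`e = 2`» of the capstone was
read as the uniformiser relation `ϖ = u · π²`; here the two readings are shown EQUIVALENT for a
pair of discrete valuation rings, so that the capstone can be stated with Mathlib's
`Ideal.ramificationIdx'` (or with the inertia degree) as its hypothesis:

1. `exists_unit_algebraMap_eq_mul_pow_ramificationIdx'`: in a DVR `B` with uniformiser `π`,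
   every non-zero `algebraMap ϖ` is `u · π ^ e` with `e = ramificationIdx' (ϖ) (π)`;
   `ramificationIdx'_eq_iff`: `ramificationIdx' (ϖ) (π) = e ↔ ∃ u, ϖ = u · π ^ e`;
2. `irreducible_algebraMap_of_ramificationIdx'_eq_one`: `e = 1` ⇒ `ϖ` stays a uniformiser of `B`
   (the «`ϖ_v ∈ F_v^×` at an inert place» reading of row E9 of N4.1);
3. for the AKLB DVR pair with `[L : K] = 2`: `ramificationIdx'_eq_one_or_two`,
   `ramificationIdx'_eq_two_iff_inertiaDeg'_eq_one`, `ramificationIdx'_eq_one_iff_inertiaDeg'_eq_two`,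
   `irreducible_algebraMap_of_inertiaDeg'_eq_finrank` (inert ⇒ `ϖ` is a uniformiser of `B`);
4. the (A13) capstone with hypothesis `ramificationIdx' (ϖ) (π) = 2`
   (`even_conductor_of_ramificationIdx'_eq_two`) and with hypothesis `inertiaDeg' (ϖ) (π) = 1`
   (`even_conductor_of_inertiaDeg'_eq_one`).

Nothing here mentions a variety, a Shimura datum or an automorphic form.  Uses an L-value-free
non-vanishing device: NO.
-/

namespace Summit.Ventures.HodgeRepro2.T5RamificationIndexUniformizer

open Summit.Ventures.HodgeRepro2.T5RamifiedQuadraticDictionary WithZero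

/-! ### 1. The exponent of the uniformiser relation is the ramification index -/

section DVR

variable {A B : Type*} [CommRing A] [CommRing B] [Algebra A B] [IsDomain B]
  [IsDiscreteValuationRing B]

/-- In a DVR `B` with uniformiser `π`, a non-zero `algebraMap ϖ` is `u · π ^ m`. -/
theorem exists_unit_algebraMap_eq_mul_pow (ϖ : A) (hϖ0 : algebraMap A B ϖ ≠ 0) (π : B)
    (hπ : Irreducible π) : ∃ (m : ℕ) (u : Bˣ), algebraMap A B ϖ = u * π ^ m :=
  IsDiscreteValuationRing.eq_unit_mul_pow_irreducible hϖ0 hπ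

/-- The exponent is the ramification index: `algebraMap ϖ = u · π ^ ramificationIdx' (ϖ) (π)`. -/
theorem exists_unit_algebraMap_eq_mul_pow_ramificationIdx' (ϖ : A) (hϖ0 : algebraMap A B ϖ ≠ 0)
    (π : B) (hπ : Irreducible π) :
    ∃ u : Bˣ, algebraMap A B ϖ = u * π ^ ((Ideal.span {ϖ}).ramificationIdx' (Ideal.span {π})) := by
  obtain ⟨m, u, h⟩ := exists_unit_algebraMap_eq_mul_pow ϖ hϖ0 π hπ
  exact ⟨u, by rw [ramificationIdx'_eq_of_algebraMap_eq_unit_mul_pow ϖ π hπ u m h]; exact h⟩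

/-- «`e = ramificationIdx'`» and «`ϖ = u · π ^ e`» are the same hypothesis. -/
theorem ramificationIdx'_eq_iff (ϖ : A) (hϖ0 : algebraMap A B ϖ ≠ 0) (π : B)
    (hπ : Irreducible π) (e : ℕ) :
    (Ideal.span {ϖ}).ramificationIdx' (Ideal.span {π}) = e ↔
      ∃ u : Bˣ, algebraMap A B ϖ = u * π ^ e :=
  ⟨fun he => he ▸ exists_unit_algebraMap_eq_mul_pow_ramificationIdx' ϖ hϖ0 π hπ,
    fun ⟨u, h⟩ => ramificationIdx'_eq_of_algebraMap_eq_unit_mul_pow ϖ π hπ u e h⟩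

/-- `e = 1`: the uniformiser of `A` stays a uniformiser of `B`. -/
theorem irreducible_algebraMap_of_ramificationIdx'_eq_one (ϖ : A) (hϖ0 : algebraMap A B ϖ ≠ 0)
    (π : B) (hπ : Irreducible π)
    (he : (Ideal.span {ϖ}).ramificationIdx' (Ideal.span {π}) = 1) :
    Irreducible (algebraMap A B ϖ) := by
  obtain ⟨u, h⟩ := (ramificationIdx'_eq_iff ϖ hϖ0 π hπ 1).mp he
  rw [h, pow_one]
  exact (irreducible_units_mul u).mpr hπ

end DVR

/-! ### 2. The quadratic DVR pair: `e ∈ {1, 2}`, `e = 2 ↔ f = 1`, `e = 1 ↔ f = 2` -/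

section Injective

variable (A K L B : Type*) [CommRing A] [Field K] [CommRing B] [Field L]
  [Algebra A K] [Algebra B L] [Algebra A B] [Algebra K L] [Algebra A L]
  [IsScalarTower A K L] [IsScalarTower A B L] [IsFractionRing A K]

include K L in
/-- `algebraMap ϖ ≠ 0` for a uniformiser `ϖ` of `A` (the AKLB map is injective). -/
theorem algebraMap_ne_zero (ϖ : A) (hϖ : Irreducible ϖ) : algebraMap A B ϖ ≠ 0 :=
  (map_ne_zero_iff _ (T5LocalFieldDictionary.algebraMap_injective A K L B)).mpr hϖ.ne_zero

end Injective

section AKLB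

variable (A K L B : Type*) [CommRing A] [Field K] [CommRing B] [Field L]
  [Algebra A K] [Algebra B L] [Algebra A B] [Algebra K L] [Algebra A L]
  [IsScalarTower A K L] [IsScalarTower A B L]
  [IsDomain A] [IsDiscreteValuationRing A] [IsFractionRing A K]
  [FiniteDimensional K L] [Algebra.IsSeparable K L] [IsIntegralClosure B A L]
  [IsDomain B] [IsDiscreteValuationRing B] [IsFractionRing B L]

/-- Inert reading: `f = [L : K]` forces `e = 1`, so `ϖ` stays a uniformiser of `B`. -/
theorem irreducible_algebraMap_of_inertiaDeg'_eq_finrank (ϖ : A) (hϖ : Irreducible ϖ) (π : B)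
    (hπ : Irreducible π)
    (hf : (Ideal.span {ϖ}).inertiaDeg' (Ideal.span {π}) = Module.finrank K L) :
    Irreducible (algebraMap A B ϖ) := by
  have h := ramificationIdx'_mul_inertiaDeg'_eq_finrank A K L B ϖ hϖ π hπ
  rw [hf] at h
  have hn : Module.finrank K L ≠ 0 := Module.finrank_pos.ne'
  exact irreducible_algebraMap_of_ramificationIdx'_eq_one ϖ (algebraMap_ne_zero A K L B ϖ hϖ) π hπ
    ((Nat.mul_eq_right hn).mp h)

variable (h2 : Module.finrank K L = 2)
include h2

/-- In a quadratic DVR pair the ramification index is `1` or `2`. -/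
theorem ramificationIdx'_eq_one_or_two (ϖ : A) (hϖ : Irreducible ϖ) (π : B)
    (hπ : Irreducible π) :
    (Ideal.span {ϖ}).ramificationIdx' (Ideal.span {π}) = 1 ∨
      (Ideal.span {ϖ}).ramificationIdx' (Ideal.span {π}) = 2 := by
  have h := ramificationIdx'_mul_inertiaDeg'_eq_finrank A K L B ϖ hϖ π hπ
  rw [h2] at h
  exact (Nat.dvd_prime Nat.prime_two).mp ⟨_, h.symm⟩

/-- «ramified» in the two readings: `e = 2 ↔ f = 1`. -/
theorem ramificationIdx'_eq_two_iff_inertiaDeg'_eq_one (ϖ : A) (hϖ : Irreducible ϖ) (π : B)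
    (hπ : Irreducible π) :
    (Ideal.span {ϖ}).ramificationIdx' (Ideal.span {π}) = 2 ↔
      (Ideal.span {ϖ}).inertiaDeg' (Ideal.span {π}) = 1 := by
  have h := ramificationIdx'_mul_inertiaDeg'_eq_finrank A K L B ϖ hϖ π hπ
  rw [h2] at h
  constructor
  · intro he
    rw [he] at h
    omega
  · intro hf
    rw [hf] at h
    omega

/-- «inert» in the two readings: `e = 1 ↔ f = 2`. -/
theorem ramificationIdx'_eq_one_iff_inertiaDeg'_eq_two (ϖ : A) (hϖ : Irreducible ϖ) (π : B)
    (hπ : Irreducible π) :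
    (Ideal.span {ϖ}).ramificationIdx' (Ideal.span {π}) = 1 ↔
      (Ideal.span {ϖ}).inertiaDeg' (Ideal.span {π}) = 2 := by
  have h := ramificationIdx'_mul_inertiaDeg'_eq_finrank A K L B ϖ hϖ π hπ
  rw [h2] at h
  constructor
  · intro he
    rw [he] at h
    omega
  · intro hf
    rw [hf] at h
    omega

end AKLB

/-! ### 3. The capstone with Mathlib's ramification index / inertia degree as hypothesis -/

section Capstone

variable (A K L B : Type*) [CommRing A] [Field K] [CommRing B] [Field L]
  [Algebra A K] [Algebra B L] [Algebra A B] [Algebra K L] [Algebra A L]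
  [IsScalarTower A K L] [IsScalarTower A B L]
  [IsDomain A] [IsDiscreteValuationRing A] [IsFractionRing A K]
  [FiniteDimensional K L] [Algebra.IsSeparable K L] [IsIntegralClosure B A L]
  [IsDomain B] [IsDiscreteValuationRing B] [IsFractionRing B L]
  [PerfectField (FractionRing A)] [Module.IsTorsionFree A B]

/-- The (A13) capstone `even_conductor_of_ramified_quadratic` (p394885) with the ramified
reading «`ϖ = u · π²`» replaced by Mathlib's `ramificationIdx' (ϖ) (π) = 2`. -/
theorem even_conductor_of_ramificationIdx'_eq_two (h2 : Module.finrank K L = 2)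
    (π : B) (hπ : Irreducible π) (ϖ : A) (hϖ : Irreducible ϖ)
    (he : (Ideal.span {ϖ}).ramificationIdx' (Ideal.span {π}) = 2)
    (d : ℕ) (hd : differentIdeal A B = Ideal.span {π ^ d})
    (vF : Valuation A (WithZero (Multiplicative ℤ))) (hvF : ∀ a : A, vF a ≤ 1)
    (hϖv : vF ϖ = exp (-1 : ℤ))
    (vE : Valuation L (WithZero (Multiplicative ℤ))) (hvE : ∀ b : B, vE (algebraMap B L b) ≤ 1)
    (hπv : vE (algebraMap B L π) = exp (-1 : ℤ))
    (s : B) (D : A) (hs : s * s = algebraMap A B D) (hs' : s ∉ Set.range (algebraMap A B))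
    (hD : vF D ≠ 0) (h2v : vF 2 ≠ 0)
    (δ : L) (c : K) (hc : c ≠ 0) (hδ : δ = algebraMap K L c * algebraMap B L s) (n : ℤ) :
    Even (2 * n + T5RamifiedParity.ord vE δ + d) := by
  obtain ⟨u, hu⟩ := (ramificationIdx'_eq_iff ϖ (algebraMap_ne_zero A K L B ϖ hϖ) π hπ 2).mp he
  exact even_conductor_of_ramified_quadratic A K L B h2 π hπ ϖ hϖ u hu d hd vF hvF hϖv vE hvE hπv
    s D hs hs' hD h2v δ c hc hδ n

/-- The same capstone with the hypothesis «`f = 1`» (`inertiaDeg' (ϖ) (π) = 1`). -/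
theorem even_conductor_of_inertiaDeg'_eq_one (h2 : Module.finrank K L = 2)
    (π : B) (hπ : Irreducible π) (ϖ : A) (hϖ : Irreducible ϖ)
    (hf : (Ideal.span {ϖ}).inertiaDeg' (Ideal.span {π}) = 1)
    (d : ℕ) (hd : differentIdeal A B = Ideal.span {π ^ d})
    (vF : Valuation A (WithZero (Multiplicative ℤ))) (hvF : ∀ a : A, vF a ≤ 1)
    (hϖv : vF ϖ = exp (-1 : ℤ))
    (vE : Valuation L (WithZero (Multiplicative ℤ))) (hvE : ∀ b : B, vE (algebraMap B L b) ≤ 1)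
    (hπv : vE (algebraMap B L π) = exp (-1 : ℤ))
    (s : B) (D : A) (hs : s * s = algebraMap A B D) (hs' : s ∉ Set.range (algebraMap A B))
    (hD : vF D ≠ 0) (h2v : vF 2 ≠ 0)
    (δ : L) (c : K) (hc : c ≠ 0) (hδ : δ = algebraMap K L c * algebraMap B L s) (n : ℤ) :
    Even (2 * n + T5RamifiedParity.ord vE δ + d) :=
  even_conductor_of_ramificationIdx'_eq_two A K L B h2 π hπ ϖ hϖ
    ((ramificationIdx'_eq_two_iff_inertiaDeg'_eq_one A K L B h2 ϖ hϖ π hπ).mpr hf)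
    d hd vF hvF hϖv vE hvE hπv s D hs hs' hD h2v δ c hc hδ n

end Capstone

end Summit.Ventures.HodgeRepro2.T5RamificationIndexUniformizer
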